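import Literature.RepresentationTheory.Kovacevic2021.SU21RelativeCochainsDegreeTwo
import HarnessLib

/-!
# Kovačević's `SU(2,1)`-modules: relative `(𝔤, 𝔨)`-cochains of degree `3` — horizontality, slot expansion,
# highest-weight values, and the vanishing criterion `C³ = 0`

Topic `RepresentationTheory/Kovacevic2021`; namespace `Literature.RepresentationTheory.Kovacevic2021`.
Theorems only (plus private plumbing); no named fact.  Sequel to `SU21RelativeCochainsDegreeTwo`.

For the module `V = 𝒟.V` of a `K`-type datum `𝒟` [Kovacevic2021, §3] and the relative Chevalley–Eilenberg
cochains `C^q(𝔤, 𝔨; V) = relCochain 𝒟 q` (`𝔤 = 𝔤𝔩₃ ⊃ 𝔨 = kSub`, `𝔭 = ⟨E₀₂, E₁₂, E₂₀, E₂₁⟩`):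

* any degree: a relative cochain vanishes on every tuple with an entry in `𝔨` (`apply_eq_zero_of_slot_mem`)
  and expands in each slot over the four `𝔭`-coordinates (`slot_expand`) — so it is determined by its values
  on tuples of the basis vectors `E₀₂, E₁₂, E₂₀, E₂₁` of `𝔭` [BorelWallach2000, I §1.2 (1):
  `C^q(𝔤,𝔨;V) = Hom_𝔨(Λ^q(𝔤/𝔨), V)`];
* degree `3` (`Λ³𝔭 = Λ²𝔭⁺ ⊗ 𝔭⁻ ⊕ 𝔭⁺ ⊗ Λ²𝔭⁻ = F_{1,0} ⊕ F_{0,1} = V_{2,3} ⊕ V_{2,-3}`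
  [BorelWallach2000, VI 4.8 (5), 4.9]): the Lie derivative formula `lieDer_three_apply`; the values
  `f(E₀₂,E₁₂,E₂₁) ∈ hw(2,3)`, `f(E₀₂,E₂₀,E₂₁) ∈ hw(2,-3)` (`apply_T2_mem_hwSpace`, `apply_T1_mem_hwSpace`) and
  `f(E₀₂,E₁₂,E₂₀) = -Y_α f(E₀₂,E₁₂,E₂₁)`, `f(E₁₂,E₂₀,E₂₁) = Y_α f(E₀₂,E₂₀,E₂₁)` (`three_descent`); hence
  **`C³(𝔤, 𝔨; V) = 0` unless `V_{2,3}` or `V_{2,-3}` is a `K`-type** (`relCochain_three_eq_bot`);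
* degree `4` is the sequel `SU21RelativeCochainsDegreeFour`.

These are the inputs for `H²` and `H³ = 0` of the six cohomological modules (`SU21CohomologyDegreeTwo`).
NOT here: the converse construction `Hom_𝔨(Λ³𝔭, V) → C³` (the equivalence, hence `dim C³`).

## References

* A. Borel, N. Wallach (2000), I §1.2 (1); VI 4.8 (5), Lemma 4.9, Thm 4.11 (11), pp. 130–133 (held chunks
  p0059, p0165–p0168). [BorelWallach2000]
* C. Chevalley, S. Eilenberg, Trans. AMS 63 (1948), §23 (23.3), (23.5), §28. [ChevalleyEilenberg1948]
* D. Kovačević, Acta Math. Spalatensia 1 (2021) 105–125, §3 Def 1, Thm 1. [Kovacevic2021]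
-/

noncomputable section

open Finsupp Module
open Literature.Algebra.Lie Literature.Algebra.Lie.ChevalleyEilenberg

namespace Literature.RepresentationTheory.Kovacevic2021

-- Mathlib idiom (Mathlib/Algebra/Lie/OfAssociative.lean): bracket on `Matrix`/`Module.End` = commutator.
attribute [local instance 100] LieRing.ofAssociativeRing

/-! ### The Lie derivative in degree `3` (any Lie algebra and module) -/

section Generic

variable {R : Type*} [CommRing R] {L : Type*} [LieRing L] [LieAlgebra R L]
  {M : Type*} [AddCommGroup M] [Module R M] [LieRingModule L M] [LieModule R L M]

/-- `(θ_x f)(y,z,w) = ⁅x, f(y,z,w)⁆ - f(⁅x,y⁆,z,w) - f(y,⁅x,z⁆,w) - f(y,z,⁅x,w⁆)` in degree `3`.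
[cite: ChevalleyEilenberg1948, §23 (23.3), (23.5)] -/
theorem lieDer_three_apply (x y z w : L) (f : Cochain R L M 3) :
    lieDer R L M 3 x f ![y, z, w] = ⁅x, f ![y, z, w]⁆ - f ![⁅x, y⁆, z, w] - f ![y, ⁅x, z⁆, w] - f ![y, z, ⁅x, w⁆] := by
  have e := congrArg (fun φ : Cochain R L M 2 => φ ![z, w]) (ins_lieDer (R := R) (M := M) 2 x y f)
  simp only [AlternatingMap.sub_apply, ins_apply, lieDer_two_apply] at e
  have h1 : (Matrix.vecCons y ![z, w] : Fin 3 → L) = ![y, z, w] := rfl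
  have h2 : (Matrix.vecCons y ![⁅x, z⁆, w] : Fin 3 → L) = ![y, ⁅x, z⁆, w] := rfl
  have h3 : (Matrix.vecCons y ![z, ⁅x, w⁆] : Fin 3 → L) = ![y, z, ⁅x, w⁆] := rfl
  have h4 : (Matrix.vecCons ⁅x, y⁆ ![z, w] : Fin 3 → L) = ![⁅x, y⁆, z, w] := rfl
  rw [h1, h2, h3, h4] at e
  rw [e]
  abel

end Generic

namespace SU21Datum

variable (𝒟 : SU21Datum)

/-! ### Horizontality and slot expansion (any degree) -/

variable {𝒟} in
/-- **A relative cochain vanishes on every tuple with an entry in `𝔨`** (horizontality `i_x f = 0`, moved to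
any slot by alternation). [cite: ChevalleyEilenberg1948, §28 (28.1)] -/
theorem apply_eq_zero_of_slot_mem {q : ℕ} {f : Cochain ℂ gl3 𝒟.V (q + 1)} (hf : f ∈ 𝒟.relCochain (q + 1))
    (v : Fin (q + 1) → gl3) (i : Fin (q + 1)) (hi : v i ∈ kSub) : f v = 0 :=
  apply_eq_zero_of_ins_eq_zero (((Subcomplex.mem_rel_succ_iff kSub q f).1 hf (v i) hi).2) v i rfl

variable {𝒟} in
/-- **Slot expansion**: `f(…, vᵢ, …) = ∑_a (vᵢ)_a f(…, E_a, …)` over the four `𝔭`-coordinates (the `𝔨`-part of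
`vᵢ` contributes nothing). [cite: BorelWallach2000, I §1.2 (1)] -/
theorem slot_expand {q : ℕ} {f : Cochain ℂ gl3 𝒟.V (q + 1)} (hf : f ∈ 𝒟.relCochain (q + 1))
    (v : Fin (q + 1) → gl3) (i : Fin (q + 1)) :
    f v = (v i) 0 2 • f (Function.update v i (E 0 2)) + (v i) 1 2 • f (Function.update v i (E 1 2))
      + (v i) 2 0 • f (Function.update v i (E 2 0)) + (v i) 2 1 • f (Function.update v i (E 2 1)) := by
  conv_lhs => rw [← Function.update_eq_self i v, ← kPart_add (v i)]
  rw [f.map_update_add, f.map_update_add, f.map_update_add, f.map_update_add, f.map_update_smul,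
    f.map_update_smul, f.map_update_smul, f.map_update_smul,
    apply_eq_zero_of_slot_mem hf _ i (by rw [Function.update_self]; exact kPart_mem _), zero_add]

variable {𝒟} in
/-- slot expansion in degree `3` (literal arity, for rewriting) [cite: BorelWallach2000, I §1.2 (1)] -/
theorem slot_expand3 {f : Cochain ℂ gl3 𝒟.V 3} (hf : f ∈ 𝒟.relCochain 3) (v : Fin 3 → gl3) (i : Fin 3) :
    f v = (v i) 0 2 • f (Function.update v i (E 0 2)) + (v i) 1 2 • f (Function.update v i (E 1 2))
      + (v i) 2 0 • f (Function.update v i (E 2 0)) + (v i) 2 1 • f (Function.update v i (E 2 1)) :=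
  slot_expand hf v i

/-! ### Slot calculus in degree `3` -/

section Slots

variable {𝒟}

/-- updating slot `0` of a `3`-tuple [folklore] -/
private theorem upd3_0 (a b c x : gl3) : Function.update ![a, b, c] 0 x = ![x, b, c] := by
  funext j
  fin_cases j <;> rfl

/-- updating slot `1` of a `3`-tuple [folklore] -/
private theorem upd3_1 (a b c x : gl3) : Function.update ![a, b, c] 1 x = ![a, x, c] := by
  funext j
  fin_cases j <;> rfl

/-- updating slot `2` of a `3`-tuple [folklore] -/
private theorem upd3_2 (a b c x : gl3) : Function.update ![a, b, c] 2 x = ![a, b, x] := by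
  funext j
  fin_cases j <;> rfl

/-- a `3`-cochain only sees `(v 0, …, v 2)` [folklore] -/
private theorem cochain3_apply_eq (f : Cochain ℂ gl3 𝒟.V 3) (v : Fin 3 → gl3) :
    f v = f ![v 0, v 1, v 2] := by
  congr 1
  funext j
  fin_cases j <;> rfl

/-- transposing slots `0`, `1` changes the sign [folklore] -/
private theorem swap3_01 (f : Cochain ℂ gl3 𝒟.V 3) (a b c : gl3) :
    f ![b, a, c] = -f ![a, b, c] := by
  have h := f.map_swap ![a, b, c] (i := 0) (j := 1) (by decide)
  have e : (![a, b, c] : Fin 3 → gl3) ∘ Equiv.swap 0 1 = ![b, a, c] := by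
    funext k
    fin_cases k <;> rfl
  rw [e] at h
  exact h

/-- transposing slots `0`, `2` changes the sign [folklore] -/
private theorem swap3_02 (f : Cochain ℂ gl3 𝒟.V 3) (a b c : gl3) :
    f ![c, b, a] = -f ![a, b, c] := by
  have h := f.map_swap ![a, b, c] (i := 0) (j := 2) (by decide)
  have e : (![a, b, c] : Fin 3 → gl3) ∘ Equiv.swap 0 2 = ![c, b, a] := by
    funext k
    fin_cases k <;> rfl
  rw [e] at h
  exact h

/-- transposing slots `1`, `2` changes the sign [folklore] -/
private theorem swap3_12 (f : Cochain ℂ gl3 𝒟.V 3) (a b c : gl3) :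
    f ![a, c, b] = -f ![a, b, c] := by
  have h := f.map_swap ![a, b, c] (i := 1) (j := 2) (by decide)
  have e : (![a, b, c] : Fin 3 → gl3) ∘ Equiv.swap 1 2 = ![a, c, b] := by
    funext k
    fin_cases k <;> rfl
  rw [e] at h
  exact h

/-- equal entries in slots `0`, `1` give `0` [folklore] -/
private theorem self3_01 (f : Cochain ℂ gl3 𝒟.V 3) (a c : gl3) : f ![a, a, c] = 0 :=
  f.map_eq_zero_of_eq ![a, a, c] (i := 0) (j := 1) rfl (by decide)

/-- equal entries in slots `0`, `2` give `0` [folklore] -/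
private theorem self3_02 (f : Cochain ℂ gl3 𝒟.V 3) (a b : gl3) : f ![a, b, a] = 0 :=
  f.map_eq_zero_of_eq ![a, b, a] (i := 0) (j := 2) rfl (by decide)

/-- equal entries in slots `1`, `2` give `0` [folklore] -/
private theorem self3_12 (f : Cochain ℂ gl3 𝒟.V 3) (a b : gl3) : f ![a, b, b] = 0 :=
  f.map_eq_zero_of_eq ![a, b, b] (i := 1) (j := 2) rfl (by decide)

/-- homogeneity in slot `0` [folklore] -/
private theorem smul3_0 (f : Cochain ℂ gl3 𝒟.V 3) (r : ℂ) (a b c : gl3) :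
    f ![r • a, b, c] = r • f ![a, b, c] := by
  have h := f.map_update_smul (v := ![a, b, c]) 0 r a
  simpa only [upd3_0] using h

/-- a zero entry in slot `0` gives `0` [folklore] -/
private theorem zero3_0 (f : Cochain ℂ gl3 𝒟.V 3) (b c : gl3) : f ![(0 : gl3), b, c] = 0 :=
  f.map_coord_zero (m := ![(0 : gl3), b, c]) 0 rfl

/-- homogeneity in slot `1` [folklore] -/
private theorem smul3_1 (f : Cochain ℂ gl3 𝒟.V 3) (r : ℂ) (a b c : gl3) :
    f ![a, r • b, c] = r • f ![a, b, c] := by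
  have h := f.map_update_smul (v := ![a, b, c]) 1 r b
  simpa only [upd3_1] using h

/-- negation in slot `1` [folklore] -/
private theorem neg3_1 (f : Cochain ℂ gl3 𝒟.V 3) (a b c : gl3) :
    f ![a, -b, c] = -f ![a, b, c] := by
  rw [← neg_one_smul ℂ b, smul3_1, neg_one_smul]

/-- a zero entry in slot `1` gives `0` [folklore] -/
private theorem zero3_1 (f : Cochain ℂ gl3 𝒟.V 3) (a c : gl3) : f ![a, (0 : gl3), c] = 0 :=
  f.map_coord_zero (m := ![a, (0 : gl3), c]) 1 rfl

/-- homogeneity in slot `2` [folklore] -/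
private theorem smul3_2 (f : Cochain ℂ gl3 𝒟.V 3) (r : ℂ) (a b c : gl3) :
    f ![a, b, r • c] = r • f ![a, b, c] := by
  have h := f.map_update_smul (v := ![a, b, c]) 2 r c
  simpa only [upd3_2] using h

/-- negation in slot `2` [folklore] -/
private theorem neg3_2 (f : Cochain ℂ gl3 𝒟.V 3) (a b c : gl3) :
    f ![a, b, -c] = -f ![a, b, c] := by
  rw [← neg_one_smul ℂ c, smul3_2, neg_one_smul]

/-- a zero entry in slot `2` gives `0` [folklore] -/
private theorem zero3_2 (f : Cochain ℂ gl3 𝒟.V 3) (a b : gl3) : f ![a, b, (0 : gl3)] = 0 :=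
  f.map_coord_zero (m := ![a, b, (0 : gl3)]) 2 rfl

end Slots

/-! ### Degree `3` -/

section Three

variable {𝒟} {f : Cochain ℂ gl3 𝒟.V 3}

/-- `Z = E₀₀ + E₁₁ - 2E₂₂ ∈ 𝔨` [folklore] -/
private theorem hZmem3 : E 0 0 + E 1 1 - (2 : ℂ) • E 2 2 ∈ kSub :=
  kSub.sub_mem (kSub.add_mem (E_mem_kSub 0 0 (by decide)) (E_mem_kSub 1 1 (by decide)))
    (kSub.smul_mem _ (E_mem_kSub 2 2 (by decide)))

/-- `H_α = E₀₀ - E₁₁ ∈ 𝔨` [folklore] -/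
private theorem hHmem3 : E 0 0 - E 1 1 ∈ kSub := kSub.sub_mem (E_mem_kSub 0 0 (by decide)) (E_mem_kSub 1 1 (by decide))

/-- `𝔨`-equivariance of a relative `3`-cochain: `⁅x, f(y,z,w)⁆ = f(⁅x,y⁆,z,w) + f(y,⁅x,z⁆,w) + f(y,z,⁅x,w⁆)` for
`x ∈ 𝔨`. [cite: ChevalleyEilenberg1948, §28 (28.2)] -/
theorem three_equivariant (hf : f ∈ 𝒟.relCochain 3) {x : gl3} (hx : x ∈ kSub) (y z w : gl3) :
    ⁅x, f ![y, z, w]⁆ = f ![⁅x, y⁆, z, w] + f ![y, ⁅x, z⁆, w] + f ![y, z, ⁅x, w⁆] := by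
  have e : lieDer ℂ gl3 𝒟.V 3 x f ![y, z, w] = (0 : Cochain ℂ gl3 𝒟.V 3) ![y, z, w] := by
    rw [((Subcomplex.mem_rel_succ_iff kSub 2 f).1 hf x hx).1]
  rw [lieDer_three_apply, AlternatingMap.zero_apply, sub_sub, sub_sub, sub_eq_zero] at e
  rw [e, add_assoc]

/-- `f(E₀₂, E₁₂, E₂₁)` is a `𝔨`-highest-weight vector of type `(2,3)` (`Λ²𝔭⁺ ⊗ 𝔭⁻ ⊃ F_{1,0} = V_{2,3}`, in fact
`Λ³𝔭 ≅ F_{1,0} ⊕ F_{0,1}`). [cite: BorelWallach2000, VI 4.8 (5), Lemma 4.9] -/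
theorem apply_T2_mem_hwSpace (hf : f ∈ 𝒟.relCochain 3) : f ![E 0 2, E 1 2, E 2 1] ∈ 𝒟.hwSpace 2 3 := by
  obtain ⟨a1, a2, a3⟩ := lie_E02
  obtain ⟨b1, b2, b3, -⟩ := lie_E12
  obtain ⟨c1, c2, c3⟩ := lie_E21
  rw [mem_hwSpace_iff_lie, three_equivariant hf (E_mem_kSub 0 1 (by decide)), a1, b1, c1,
    three_equivariant hf hHmem3, a2, b2, c2, three_equivariant hf hZmem3, a3, b3, c3]
  simp only [zero3_0, zero3_2, self3_01, neg3_1, smul3_0, smul3_1, smul3_2]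
  push_cast
  refine ⟨by module, by module, by module⟩

/-- `f(E₀₂, E₂₀, E₂₁)` is a `𝔨`-highest-weight vector of type `(2,-3)` (`𝔭⁺ ⊗ Λ²𝔭⁻ ⊃ F_{0,1} = V_{2,-3}`).
[cite: BorelWallach2000, VI 4.8 (5), Lemma 4.9] -/
theorem apply_T1_mem_hwSpace (hf : f ∈ 𝒟.relCochain 3) : f ![E 0 2, E 2 0, E 2 1] ∈ 𝒟.hwSpace 2 (-3) := by
  obtain ⟨a1, a2, a3⟩ := lie_E02
  obtain ⟨b1, b2, b3, -⟩ := lie_E20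
  obtain ⟨c1, c2, c3⟩ := lie_E21
  rw [mem_hwSpace_iff_lie, three_equivariant hf (E_mem_kSub 0 1 (by decide)), a1, b1, c1,
    three_equivariant hf hHmem3, a2, b2, c2, three_equivariant hf hZmem3, a3, b3, c3]
  simp only [zero3_0, zero3_2, self3_12, neg3_1, smul3_0, smul3_1, smul3_2]
  push_cast
  refine ⟨by module, by module, by module⟩

/-- the `Y_α`-descent relations `f(E₀₂,E₁₂,E₂₀) = -Y_α f(E₀₂,E₁₂,E₂₁)` and `f(E₁₂,E₂₀,E₂₁) = Y_α f(E₀₂,E₂₀,E₂₁)`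
(from `θ_{E₁₀} f = 0`). [cite: Kovacevic2021, §3 Def 1] -/
theorem three_descent (hf : f ∈ 𝒟.relCochain 3) :
    f ![E 0 2, E 1 2, E 2 0] = -𝒟.Ya (f ![E 0 2, E 1 2, E 2 1]) ∧
      f ![E 1 2, E 2 0, E 2 1] = 𝒟.Ya (f ![E 0 2, E 2 0, E 2 1]) := by
  obtain ⟨e1, e2⟩ := lie_E10
  obtain ⟨-, -, -, c4⟩ := lie_E12
  obtain ⟨-, -, -, d4⟩ := lie_E20
  have hY : ∀ v : 𝒟.V, 𝒟.Ya v = ⁅E 1 0, v⁆ := fun v => by rw [lie_def, ρfun_E]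
  refine ⟨?_, ?_⟩
  · rw [hY, three_equivariant hf (E_mem_kSub 1 0 (by decide)), e1, c4, e2, self3_01, zero3_1, neg3_2]
    abel
  · rw [hY, three_equivariant hf (E_mem_kSub 1 0 (by decide)), e1, d4, e2, zero3_1, neg3_2, self3_12]
    abel

/-- **`C³(𝔤, 𝔨; V) = 0` if neither `V_{2,3}` nor `V_{2,-3}` is a `K`-type of `V`** (then all four basis values
vanish, hence `f` vanishes on all triples of basis vectors of `𝔭`, hence everywhere by slot expansion).
[cite: BorelWallach2000, VI Thm 4.11 (11)] -/
theorem relCochain_three_eq_bot (h₁ : ((2 : ℤ), (3 : ℤ)) ∉ 𝒟.S) (h₂ : ((2 : ℤ), (-3 : ℤ)) ∉ 𝒟.S) :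
    𝒟.relCochain 3 = ⊥ := by
  rw [Submodule.eq_bot_iff]
  intro f hf
  have hT2 : f ![E 0 2, E 1 2, E 2 1] = 0 := by
    have h := apply_T2_mem_hwSpace hf
    rwa [hwSpace_eq_span, vec_of_not_mem 1 h₁, Submodule.span_zero_singleton, Submodule.mem_bot] at h
  have hT1 : f ![E 0 2, E 2 0, E 2 1] = 0 := by
    have h := apply_T1_mem_hwSpace hf
    rwa [hwSpace_eq_span, vec_of_not_mem 1 h₂, Submodule.span_zero_singleton, Submodule.mem_bot] at h
  have hT3 : f ![E 0 2, E 1 2, E 2 0] = 0 := by rw [(three_descent hf).1, hT2, map_zero, neg_zero]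
  have hT0 : f ![E 1 2, E 2 0, E 2 1] = 0 := by rw [(three_descent hf).2, hT1, map_zero]
  have z1 : f ![E 0 2, E 2 0, E 1 2] = 0 := by
    rw [swap3_12 f (E 0 2) (E 1 2) (E 2 0), hT3]
    simp
  have z2 : f ![E 0 2, E 2 1, E 1 2] = 0 := by
    rw [swap3_12 f (E 0 2) (E 1 2) (E 2 1), hT2]
    simp
  have z3 : f ![E 0 2, E 2 1, E 2 0] = 0 := by
    rw [swap3_12 f (E 0 2) (E 2 0) (E 2 1), hT1]
    simp
  have z4 : f ![E 1 2, E 0 2, E 2 0] = 0 := by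
    rw [swap3_01 f (E 0 2) (E 1 2) (E 2 0), hT3]
    simp
  have z5 : f ![E 1 2, E 0 2, E 2 1] = 0 := by
    rw [swap3_01 f (E 0 2) (E 1 2) (E 2 1), hT2]
    simp
  have z6 : f ![E 1 2, E 2 0, E 0 2] = 0 := by
    rw [swap3_02 f (E 0 2) (E 2 0) (E 1 2), swap3_12 f (E 0 2) (E 1 2) (E 2 0), hT3]
    simp
  have z7 : f ![E 1 2, E 2 1, E 0 2] = 0 := by
    rw [swap3_02 f (E 0 2) (E 2 1) (E 1 2), swap3_12 f (E 0 2) (E 1 2) (E 2 1), hT2]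
    simp
  have z8 : f ![E 1 2, E 2 1, E 2 0] = 0 := by
    rw [swap3_12 f (E 1 2) (E 2 0) (E 2 1), hT0]
    simp
  have z9 : f ![E 2 0, E 0 2, E 1 2] = 0 := by
    rw [swap3_01 f (E 0 2) (E 2 0) (E 1 2), swap3_12 f (E 0 2) (E 1 2) (E 2 0), hT3]
    simp
  have z10 : f ![E 2 0, E 0 2, E 2 1] = 0 := by
    rw [swap3_01 f (E 0 2) (E 2 0) (E 2 1), hT1]
    simp
  have z11 : f ![E 2 0, E 1 2, E 0 2] = 0 := by
    rw [swap3_02 f (E 0 2) (E 1 2) (E 2 0), hT3]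
    simp
  have z12 : f ![E 2 0, E 1 2, E 2 1] = 0 := by
    rw [swap3_01 f (E 1 2) (E 2 0) (E 2 1), hT0]
    simp
  have z13 : f ![E 2 0, E 2 1, E 0 2] = 0 := by
    rw [swap3_02 f (E 0 2) (E 2 1) (E 2 0), swap3_12 f (E 0 2) (E 2 0) (E 2 1), hT1]
    simp
  have z14 : f ![E 2 0, E 2 1, E 1 2] = 0 := by
    rw [swap3_02 f (E 1 2) (E 2 1) (E 2 0), swap3_12 f (E 1 2) (E 2 0) (E 2 1), hT0]
    simp
  have z15 : f ![E 2 1, E 0 2, E 1 2] = 0 := by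
    rw [swap3_01 f (E 0 2) (E 2 1) (E 1 2), swap3_12 f (E 0 2) (E 1 2) (E 2 1), hT2]
    simp
  have z16 : f ![E 2 1, E 0 2, E 2 0] = 0 := by
    rw [swap3_01 f (E 0 2) (E 2 1) (E 2 0), swap3_12 f (E 0 2) (E 2 0) (E 2 1), hT1]
    simp
  have z17 : f ![E 2 1, E 1 2, E 0 2] = 0 := by
    rw [swap3_02 f (E 0 2) (E 1 2) (E 2 1), hT2]
    simp
  have z18 : f ![E 2 1, E 1 2, E 2 0] = 0 := by
    rw [swap3_01 f (E 1 2) (E 2 1) (E 2 0), swap3_12 f (E 1 2) (E 2 0) (E 2 1), hT0]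
    simp
  have z19 : f ![E 2 1, E 2 0, E 0 2] = 0 := by
    rw [swap3_02 f (E 0 2) (E 2 0) (E 2 1), hT1]
    simp
  have z20 : f ![E 2 1, E 2 0, E 1 2] = 0 := by
    rw [swap3_02 f (E 1 2) (E 2 0) (E 2 1), hT0]
    simp
  refine AlternatingMap.ext fun v => ?_
  rw [cochain3_apply_eq f v, AlternatingMap.zero_apply]
  generalize v 0 = y
  generalize v 1 = z
  generalize v 2 = w
  rw [slot_expand3 hf ![y, z, w] 0]
  simp only [upd3_0, Matrix.cons_val_zero]
  rw [slot_expand3 hf ![E 0 2, z, w] 1, slot_expand3 hf ![E 1 2, z, w] 1, slot_expand3 hf ![E 2 0, z, w] 1, slot_expand3 hf ![E 2 1, z, w] 1]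
  simp only [upd3_1, Matrix.cons_val_one, self3_01, smul_zero, add_zero, zero_add]
  rw [slot_expand3 hf ![E 0 2, E 1 2, w] 2,
    slot_expand3 hf ![E 0 2, E 2 0, w] 2,
    slot_expand3 hf ![E 0 2, E 2 1, w] 2,
    slot_expand3 hf ![E 1 2, E 0 2, w] 2,
    slot_expand3 hf ![E 1 2, E 2 0, w] 2,
    slot_expand3 hf ![E 1 2, E 2 1, w] 2,
    slot_expand3 hf ![E 2 0, E 0 2, w] 2,
    slot_expand3 hf ![E 2 0, E 1 2, w] 2,
    slot_expand3 hf ![E 2 0, E 2 1, w] 2,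
    slot_expand3 hf ![E 2 1, E 0 2, w] 2,
    slot_expand3 hf ![E 2 1, E 1 2, w] 2,
    slot_expand3 hf ![E 2 1, E 2 0, w] 2]
  simp only [upd3_2, Matrix.cons_val_two, Matrix.tail_cons, Matrix.head_cons, self3_02, self3_12, hT0, hT1, hT2, hT3,
    z1, z2, z3, z4, z5, z6, z7, z8, z9, z10, z11, z12, z13, z14, z15, z16, z17, z18, z19, z20, smul_zero, add_zero]

end Three


end SU21Datum

end Literature.RepresentationTheory.Kovacevic2021
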